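import Summits.PneNP.PneNP.Theorems.SymmetryBudgetNoHiddenOrderProgramModsB
import Summits.PneNP.PneNP.Theorems.SymmetryBudgetNoHiddenOrderValueOrDefs

/-!
# `NoHiddenOrder` (stmt-PneNP-14781), (R2c) VI: the window canoniser program — module records, the values

Route `PneNP/SymmetryBudget`; continues `SymmetryBudgetNoHiddenOrderProgramModsB.lean`.  The `VOr`, `VAnd` and `Value` records
(`vorRec L`, `vandRec L`, `valRec L`) of a label `L` over the program `prog m` (admissibility `admW m`; all equations by `rfl`).
Definitions only; supports stmt-PneNP-14781.
-/

set_option linter.dupNamespace false -- `Summit.PneNP.PneNP.…` (D-0017 single-conjunct layout)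

namespace Summit.PneNP.PneNP.Theorems

open Finset CGBits BranchSum Literature.Computability.Complexity Literature.Computability.Complexity.SymProg

namespace WCanon.R2c

variable {m : ℕ}

/-- The refinement record of the candidate vertex `y` of label `L`. [folklore] -/
noncomputable def rvOr (L : FLab m) (y : WV m) : RefVal (prog m) (WV m) (pN m) (wn m) (wn m) :=
  rvRec (orRIIn L y) (fun g => .vor L (.rv y g)) (fun _ _ h => (OrGate.rv.inj (Gt.vor.inj h).2).2) (fun _ => rfl) (fun _ => rfl)

/-- **The `VOr` record of label `L`.** [folklore] -/
noncomputable def vorRec (L : FLab m) : VOr (prog m) (WV m) (pN m) (wn m) (wn m) (lU L) (lX L) (lLam L) (admW m) where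
  mem := memW L (kF m)
  val := valW L (kF m)
  lt u v := Sum.inr (.an L (kF m) (.oLt u v))
  eq u v := Sum.inr (.an L (kF m) (.oEq u v))
  sel u := Sum.inr (.an L (kF m) (.mcSel u))
  adj := adjWire
  cdOK := cdOKW L
  cdVal := cdValW L
  cdOk := cdOkW L
  cdBit := cdBitW L
  ff := .ff
  ltx y u v := .vor L (.ltx y u v)
  eqx y u v := .vor L (.eqx y u v)
  RVc := rvOr L
  bothc κ w c := .vor L (.bothc κ w c)
  nonec κ w c := .vor L (.nonec κ w c)
  xnc κ w c := .vor L (.xnc κ w c)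
  eqc κ := .vor L (.eqc κ)
  kept κ := .vor L (.kept κ)
  cmu y c' c u := .vor L (.cmu y c' c u)
  cm y c' c := .vor L (.cm y c' c)
  lc κ i c' c := .vor L (.lc κ i c' c)
  liftC κ i c := .vor L (.liftC κ i c)
  VC := voRec (orLW L) (fun g => .vor L (.vc g)) (fun _ => rfl) (fun _ => rfl)
  beat κ' κ := .vor L (.beat κ' κ)
  nbeat κ' κ := .vor L (.nbeat κ' κ)
  best κ := .vor L (.best κ)
  orOk := .vor L .orOk
  ob κ b := .vor L (.ob κ b)
  orBit b := .vor L (.orBit b)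
  kind_ff := rfl
  srcs_ff := rfl
  kind_ltx _ _ _ := rfl
  srcs_ltx _ _ _ := rfl
  kind_eqx _ _ _ := rfl
  srcs_eqx _ _ _ := rfl
  RVc_mem _ := rfl
  RVc_adj _ := rfl
  RVc_lt0 _ _ _ := rfl
  RVc_eq0 _ _ _ := rfl
  kind_bothc _ _ _ := rfl
  srcs_bothc _ _ _ := rfl
  kind_nonec _ _ _ := rfl
  srcs_nonec _ _ _ := rfl
  kind_xnc _ _ _ := rfl
  srcs_xnc _ _ _ := rfl
  kind_eqc _ := rfl
  srcs_eqc _ := rfl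
  kind_kept _ := rfl
  srcs_kept _ := rfl
  kind_cmu _ _ _ _ := rfl
  srcs_cmu _ _ _ _ := rfl
  kind_cm _ _ _ := rfl
  srcs_cm _ _ _ := rfl
  kind_lc _ _ _ _ := rfl
  srcs_lc _ _ _ _ := rfl
  kind_liftC _ _ _ := rfl
  srcs_liftC _ _ _ := rfl
  VC_b _ _ := rfl
  kind_beat _ _ := rfl
  srcs_beat _ _ := rfl
  kind_nbeat _ _ := rfl
  srcs_nbeat _ _ := rfl
  kind_best _ := rfl
  srcs_best _ := rfl
  kind_orOk := rfl
  srcs_orOk := rfl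
  kind_ob _ _ := rfl
  srcs_ob _ _ := rfl
  kind_orBit _ := rfl
  srcs_orBit _ := rfl

/-- **The `VAnd` record of label `L`.** [folklore] -/
noncomputable def vandRec (L : FLab m) : VAnd (prog m) (WV m) (wn m) (lU L) where
  mem := memW L (kF m)
  val := valW L (kF m)
  reach := reachW L
  tw u w := Sum.inr (.an L (kF m) (.swTw u w .tw))
  ptOk := ptOkW L
  ptBit := ptBitW L
  ff := .ff
  nreach u w := .vand L (.nreach u w)
  partAt u U' := .vand L (.partAt u U')
  isPart U' := .vand L (.isPart U')
  nisPart U' := .vand L (.nisPart U')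
  imp U' := .vand L (.imp U')
  andOk := .vand L .andOk
  VP := vaRec (ptBitW L) (fun g => .vand L (.vc g)) (fun _ => rfl) (fun _ => rfl)
  pg U' U'' u := .vand L (.pg U' U'' u)
  cntGe U' t := .vand L (.cntGe U' t)
  ncntGe U' t := .vand L (.ncntGe U' t)
  cntIs U' t := .vand L (.cntIs U' t)
  eqp U' U'' := .vand L (.eqp U' U'')
  multGe U' q := .vand L (.multGe U' q)
  rowSrc i U' t := .vand L (.rowSrc i U' t)
  pcb i c U' t o := .vand L (.pcb i c U' t o)
  pCol i c := .vand L (.pCol i c)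
  scp i j U' t := .vand L (.scp i j U' t)
  sameCopy i j := .vand L (.sameCopy i j)
  nsame i j := .vand L (.nsame i j)
  pab i j U' t o o' := .vand L (.pab i j U' t o o')
  pOwn i j := .vand L (.pOwn i j)
  swu c c' u w := .vand L (.swu c c' u w)
  swcc c c' := .vand L (.swcc c c')
  xcp i j c c' := .vand L (.xcp i j c c')
  xc i j := .vand L (.xc i j)
  pX i j := .vand L (.pX i j)
  pAdj i j := .vand L (.pAdj i j)
  kind_ff := rfl
  srcs_ff := rfl
  kind_nreach _ _ := rfl
  srcs_nreach _ _ := rfl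
  kind_partAt _ _ := rfl
  srcs_partAt _ _ := rfl
  kind_isPart _ := rfl
  srcs_isPart _ := rfl
  kind_nisPart _ := rfl
  srcs_nisPart _ := rfl
  kind_imp _ := rfl
  srcs_imp _ := rfl
  kind_andOk := rfl
  srcs_andOk := rfl
  VP_b _ _ := rfl
  kind_pg _ _ _ := rfl
  srcs_pg _ _ _ := rfl
  kind_cntGe _ _ := rfl
  srcs_cntGe _ _ := rfl
  pg_injective U' Uu Uu' h := by
    have h' := AndGate.pg.inj (Gt.vand.inj h).2
    exact Prod.ext h'.2.1 h'.2.2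
  kind_ncntGe _ _ := rfl
  srcs_ncntGe _ _ := rfl
  kind_cntIs _ _ := rfl
  srcs_cntIs _ _ := rfl
  kind_eqp _ _ := rfl
  srcs_eqp _ _ := rfl
  kind_multGe _ _ := rfl
  srcs_multGe _ _ := rfl
  eqp_injective U' U₁ U₂ h := (AndGate.eqp.inj (Gt.vand.inj h).2).2
  kind_rowSrc _ _ _ := rfl
  srcs_rowSrc _ _ _ := rfl
  kind_pcb _ _ _ _ _ := rfl
  srcs_pcb _ _ _ _ _ := rfl
  kind_pCol _ _ := rfl
  srcs_pCol _ _ := rfl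
  kind_scp _ _ _ _ := rfl
  srcs_scp _ _ _ _ := rfl
  kind_sameCopy _ _ := rfl
  srcs_sameCopy _ _ := rfl
  kind_nsame _ _ := rfl
  srcs_nsame _ _ := rfl
  kind_pab _ _ _ _ _ _ := rfl
  srcs_pab _ _ _ _ _ _ := rfl
  kind_pOwn _ _ := rfl
  srcs_pOwn _ _ := rfl
  kind_swu _ _ _ _ := rfl
  srcs_swu _ _ _ _ := rfl
  kind_swcc _ _ := rfl
  srcs_swcc _ _ := rfl
  kind_xcp _ _ _ _ := rfl
  srcs_xcp _ _ _ _ := rfl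
  kind_xc _ _ := rfl
  srcs_xc _ _ := rfl
  kind_pX _ _ := rfl
  srcs_pX _ _ := rfl
  kind_pAdj _ _ := rfl
  srcs_pAdj _ _ := rfl

/-- **The `Value` record of label `L`.** [folklore] -/
noncomputable def valRec (L : FLab m) :
    Value (prog m) (WV m) (pN m) (wn m) (lU L) (wn m) (pF m) (lX L) (lLam L) (admW m) where
  Dc := dcRec L
  VO := vorRec L
  VA := vandRec L
  ff := .ff
  ndead := .vl L .ndead
  decOK := .vl L .decOK
  a1 := .vl L .a1
  a2 := .vl L .a2
  okk := .vl L .okk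
  ok := .vl L .ok
  b1 b := .vl L (.b1 b)
  b2 b := .vl L (.b2 b)
  bb b := .vl L (.bb b)
  bit b := .vl L (.bit b)
  VO_mem := rfl
  VO_val := rfl
  VO_lt _ _ := rfl
  VO_eq _ _ := rfl
  VO_sel _ := rfl
  VO_adj := rfl
  VA_mem := rfl
  VA_val := rfl
  VA_reach _ _ := rfl
  VA_tw _ _ := rfl
  kind_ff := rfl
  srcs_ff := rfl
  kind_ndead := rfl
  srcs_ndead := rfl
  kind_decOK := rfl
  srcs_decOK := rfl
  kind_a1 := rfl
  srcs_a1 := rfl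
  kind_a2 := rfl
  srcs_a2 := rfl
  kind_okk := rfl
  srcs_okk := rfl
  kind_ok := rfl
  srcs_ok := rfl
  kind_b1 _ := rfl
  srcs_b1 b := by
    show vlSrcs L (.b1 b) = _
    have : awW L b = (vandRec L).aw b := by
      unfold awW VAnd.aw
      rcases bdec b with ⟨i, c⟩ | ⟨i, j⟩ <;> rfl
    simp only [vlSrcs, this]
    rfl
  kind_b2 _ := rfl
  srcs_b2 _ := rfl
  kind_bb _ := rfl
  srcs_bb _ := rfl
  kind_bit _ := rfl
  srcs_bit b := by
    show vlSrcs L (.bit b) = _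
    simp only [vlSrcs]
    split
    · congr 1
      rcases bdec b with ⟨i, c⟩ | ⟨i, j⟩ <;> rfl
    · rfl

end WCanon.R2c

end Summit.PneNP.PneNP.Theorems
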